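import Mathlib
import HarnessLib

/-!
# ValiantsHypothesis / LacunarySymmetroid — crux `MatrixDescartes` (stmt-ValiantsHypothesis-18050, V1),
# line «osculation-law»: the NON-MONIC QUARTIC cusp curve — coefficientwise certificate of
# `a₄⁸·H = Q·Ψ + R₃b³ + R₂b² + R₁b + R₀`, part C

Pseudo-division of the bordered log-Hessian of `Ψ = a₄b⁴ + a₃b³ + a₂b² + a₁b + a₀` (102 monomials, `b`-degree 12) by `Ψ`
(multiplier `a₄⁸`; `Q` 362 monomials; remainders `R₃, R₂, R₁, R₀` of 121, 184, 198, 164 monomials, homogeneous of degree 11 in the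
letter data `Aₖ = aₖ(t)`, `Tₖ = θaₖ(t)`, `Uₖ = θ²aₖ(t)`, isobaric weights `11s + 9 … 11s + 12` for `wt aₖ = s + 4 − k`), certified
COEFFICIENTWISE (`hess_expand4n`, `coeff4n_0 … coeff4n_12`, split over parts by size).  No definitions, no named facts.

Honest framing: helper algebra for the rank-four COLUMN `(4,s)` of an UNREGISTERED V1 law line (the non-monic twin of the
`(4,0)` piece); `OsculationLaw` (all `m`), `PeelInequality`, `MatrixDescartes`, Conjecture B and `VP ≠ VNP` are OPEN / NOT proved.
-/

-- `Summit.ValiantsHypothesis.ValiantsHypothesis.…` is the tree's mandated single-conjunct layout (Sub = Summit).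
set_option linter.dupNamespace false

noncomputable section

namespace Summit.ValiantsHypothesis.ValiantsHypothesis.Theorems.LacunarySymmetroidMatrixDescartes

open Polynomial Set
open scoped BigOperators

namespace OsculationCuspQuartic
set_option maxHeartbeats 4000000 in
set_option maxRecDepth 100000 in
/-- Coefficient of `b^9` in the reduction (`q`-coefficients of the quotient against the divisor's coefficients,
plus the remainder's coefficient). [folklore] -/
theorem coeff4n_9 (A₄ A₃ A₂ A₁ T₄ T₃ T₂ T₁ U₄ U₃ U₂ U₁ : ℝ) :
    A₄ ^ (8 : ℕ) * (16 * A₄ ^ (2 : ℕ) * U₁ + 24 * A₄ * A₃ * U₂ + 16 * A₄ * A₂ * U₃ + 8 * A₄ * A₁ * U₄ - 8 * A₄ * T₄ * T₁ - 8 * A₄ * T₃ * T₂ + 9 * A₃ ^ (2 : ℕ) * U₃ + 12 * A₃ * A₂ * U₄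
          - 18 * A₃ * T₄ * T₂ - 9 * A₃ * T₃ ^ (2 : ℕ) - 20 * A₂ * T₄ * T₃ - 7 * A₁ * T₄ ^ (2 : ℕ)) =
        (16 * A₄ ^ (9 : ℕ) * U₁ + 8 * A₄ ^ (8 : ℕ) * A₃ * U₂ - 8 * A₄ ^ (8 : ℕ) * A₁ * U₄ - 8 * A₄ ^ (8 : ℕ) * T₄ * T₁ - 8 * A₄ ^ (8 : ℕ) * T₃ * T₂ + A₄ ^ (7 : ℕ) * A₃ ^ (2 : ℕ) * U₃ + 4 * A₄ ^ (7 : ℕ) * A₃ * A₂ * U₄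
            - 2 * A₄ ^ (7 : ℕ) * A₃ * T₄ * T₂ - A₄ ^ (7 : ℕ) * A₃ * T₃ ^ (2 : ℕ) + 4 * A₄ ^ (7 : ℕ) * A₂ * T₄ * T₃ + 9 * A₄ ^ (7 : ℕ) * A₁ * T₄ ^ (2 : ℕ) - A₄ ^ (6 : ℕ) * A₃ ^ (3 : ℕ) * U₄ - 5 * A₄ ^ (6 : ℕ) * A₃ * A₂ * T₄ ^ (2 : ℕ)
            + A₄ ^ (5 : ℕ) * A₃ ^ (3 : ℕ) * T₄ ^ (2 : ℕ)) * A₄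
        + (16 * A₄ ^ (9 : ℕ) * U₂ + 8 * A₄ ^ (8 : ℕ) * A₃ * U₃ - 16 * A₄ ^ (8 : ℕ) * T₄ * T₂ - 8 * A₄ ^ (8 : ℕ) * T₃ ^ (2 : ℕ) + A₄ ^ (7 : ℕ) * A₃ ^ (2 : ℕ) * U₄ + 4 * A₄ ^ (7 : ℕ) * A₂ * T₄ ^ (2 : ℕ) - A₄ ^ (6 : ℕ) * A₃ ^ (2 : ℕ) * T₄ ^ (2 : ℕ)) * A₃
        + (16 * A₄ ^ (9 : ℕ) * U₃ + 8 * A₄ ^ (8 : ℕ) * A₃ * U₄ - 24 * A₄ ^ (8 : ℕ) * T₄ * T₃ + A₄ ^ (7 : ℕ) * A₃ * T₄ ^ (2 : ℕ)) * A₂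
        + (16 * A₄ ^ (9 : ℕ) * U₄ - 16 * A₄ ^ (8 : ℕ) * T₄ ^ (2 : ℕ)) * A₁ := by
  ring

set_option maxHeartbeats 4000000 in
set_option maxRecDepth 100000 in
/-- Coefficient of `b^10` in the reduction (`q`-coefficients of the quotient against the divisor's coefficients,
plus the remainder's coefficient). [folklore] -/
theorem coeff4n_10 (A₄ A₃ A₂ T₄ T₃ T₂ U₄ U₃ U₂ : ℝ) :
    A₄ ^ (8 : ℕ) * (16 * A₄ ^ (2 : ℕ) * U₂ + 24 * A₄ * A₃ * U₃ + 16 * A₄ * A₂ * U₄ - 16 * A₄ * T₄ * T₂ - 8 * A₄ * T₃ ^ (2 : ℕ) + 9 * A₃ ^ (2 : ℕ) * U₄ - 24 * A₃ * T₄ * T₃ - 12 * A₂ * T₄ ^ (2 : ℕ)) =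
        (16 * A₄ ^ (9 : ℕ) * U₂ + 8 * A₄ ^ (8 : ℕ) * A₃ * U₃ - 16 * A₄ ^ (8 : ℕ) * T₄ * T₂ - 8 * A₄ ^ (8 : ℕ) * T₃ ^ (2 : ℕ) + A₄ ^ (7 : ℕ) * A₃ ^ (2 : ℕ) * U₄ + 4 * A₄ ^ (7 : ℕ) * A₂ * T₄ ^ (2 : ℕ) - A₄ ^ (6 : ℕ) * A₃ ^ (2 : ℕ) * T₄ ^ (2 : ℕ)) * A₄
        + (16 * A₄ ^ (9 : ℕ) * U₃ + 8 * A₄ ^ (8 : ℕ) * A₃ * U₄ - 24 * A₄ ^ (8 : ℕ) * T₄ * T₃ + A₄ ^ (7 : ℕ) * A₃ * T₄ ^ (2 : ℕ)) * A₃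
        + (16 * A₄ ^ (9 : ℕ) * U₄ - 16 * A₄ ^ (8 : ℕ) * T₄ ^ (2 : ℕ)) * A₂ := by
  ring

set_option maxHeartbeats 4000000 in
set_option maxRecDepth 100000 in
/-- Coefficient of `b^11` in the reduction (`q`-coefficients of the quotient against the divisor's coefficients,
plus the remainder's coefficient). [folklore] -/
theorem coeff4n_11 (A₄ A₃ T₄ T₃ U₄ U₃ : ℝ) :
    A₄ ^ (8 : ℕ) * (16 * A₄ ^ (2 : ℕ) * U₃ + 24 * A₄ * A₃ * U₄ - 24 * A₄ * T₄ * T₃ - 15 * A₃ * T₄ ^ (2 : ℕ)) =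
        (16 * A₄ ^ (9 : ℕ) * U₃ + 8 * A₄ ^ (8 : ℕ) * A₃ * U₄ - 24 * A₄ ^ (8 : ℕ) * T₄ * T₃ + A₄ ^ (7 : ℕ) * A₃ * T₄ ^ (2 : ℕ)) * A₄
        + (16 * A₄ ^ (9 : ℕ) * U₄ - 16 * A₄ ^ (8 : ℕ) * T₄ ^ (2 : ℕ)) * A₃ := by
  ring

set_option maxHeartbeats 4000000 in
set_option maxRecDepth 100000 in
/-- Coefficient of `b^12` in the reduction (`q`-coefficients of the quotient against the divisor's coefficients,
plus the remainder's coefficient). [folklore] -/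
theorem coeff4n_12 (A₄ T₄ U₄ : ℝ) :
    A₄ ^ (8 : ℕ) * (16 * A₄ ^ (2 : ℕ) * U₄ - 16 * A₄ * T₄ ^ (2 : ℕ)) =
        (16 * A₄ ^ (9 : ℕ) * U₄ - 16 * A₄ ^ (8 : ℕ) * T₄ ^ (2 : ℕ)) * A₄ := by
  ring

end OsculationCuspQuartic

end Summit.ValiantsHypothesis.ValiantsHypothesis.Theorems.LacunarySymmetroidMatrixDescartes
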